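import Summits.Parity.GeneralizedHardyLittlewood.Theorems.LeeYangFibresAbsoluteUpgradePencilDiscAux
import Summits.Parity.GeneralizedHardyLittlewood.Theorems.LeeYangFibresAbsoluteUpgradePencilDiscAux2
import Literature.NumberTheory.LFunctions.UniversalityZeros
import HarnessLib

/-!
# Route `LeeYangFibres`, crux `AbsoluteUpgrade` (stmt-Parity-14116), line `dip-margin-rate-exchange`:
# stub `stub_pencilDiscOfChain` — the chain zero of the model pencil transfers to the tilted row

We prove the registered stub `stub_pencilDiscOfChain : PencilChainZero → ModGammaDisc → MarginPoly` of the
skeleton `Cruxes/AbsoluteUpgrade/Lines/dip_margin_rate_exchange.lean` (vocabulary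
`LeeYangFibresAbsoluteUpgradeDipDefs.lean`).  `MarginPoly` is the line's one new parity-free theorem: for every
`m`, for `u ≥ u₀(m)`, every tilt `u^{-m} ≤ |θ| ≤ 2` and every coefficient row `b` with
`|b_j - (1 + θ(-1)^j) I_{j+1}(u)| ≤ u^{-(m+4)} I_{j+1}(u) + u^{-u}` (`j < u`), the polynomial `Σ_{j<u} b_j z^j`
has a NON-REAL zero.  (The non-negativity of `b` in `MarginPoly` is not used.)

PROOF (lead seat c1's plan; only `u → ∞` is used, every inequality has room).  Put `Λ := log(u-1) - γ`, so
that the model row of `ModGammaDisc` is `M(z) = e^{-γz}(u-1)^z/Γ(1+z) = e^{Λz}/Γ(1+z)` (`pencilDisc_model_eq`)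
with `‖(u-1)^z‖ = e^{Re z (Λ+γ)}`.  With `τ := -θ`, `PencilChainZero` (at `A := m`; its hypothesis
`log|τ|/(2Λ) ≥ -m` holds because `|τ| ≥ u^{-m}` and `log u ≤ 2Λ`) hands us `ζ` with `3/4 < Im ζ < 5/4`,
`|Re ζ - log|τ|/(2Λ)| < 1/4`, the exact chain equation `e^{2Λζ}Γ(1-ζ) = τΓ(1+ζ)` — i.e. `f(ζ) = 0` for the
model pencil in product form `f(z) = e^{-Λz}(e^{2Λz}Γ(1-z) - τΓ(1+z))/(Γ(1+z)Γ(1-z)) = M(z) + θM(-z)` — the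
clearance `|τΓ(1+z) - e^{2Λz}Γ(1-z)| ≥ (|τ|/5)|Γ(1+z)|` on the circle `|z-ζ| = ρ := 1/(4Λ)`, and
`C⁻¹ ≤ |Γ(1∓z)| ≤ C` on the closed disc.  Taking norms in the chain equation gives the KEY SIZE RELATION
`e^{2Λ Re ζ} ≤ C²|τ|` (`pencilDisc_chain_size`).  On the circle `‖f‖ ≥ |τ|e^{-Λ Re z}/(5C) ≥ δ := |τ|/(8Ce^{Λ Re ζ})`
(`Λρ = 1/4`, `e^{-1/4} ≥ 3/4`).  On the closed disc, with `g(z) = Σ b_j z^j` and `F(z) = Σ I_{j+1}(u) z^j`,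
`g - f = [g - (F(z) + θF(-z))] + [F(z) - M(z)] + θ[F(-z) - M(-z)]`; `ModGammaDisc` (level `K = m+2`, as
`‖z‖ ≤ m + 3`) bounds the last two by `(C_K/u)e^{±Re z(Λ+γ)}` and the coefficient hypothesis bounds the first by
`u^{-(m+4)}e^{(|Re z|+2) log u} + u^{-u}·u(m+3)^u`; the four real estimates of the `Aux2` file make the total
`≤ δ/8 + δ/8 + δ/16 + δ/16 < δ/2` once `u ≥ B(m, C, C_K)`.  The maximum-modulus form of Rouché
(`Literature.NumberTheory.LFunctions.exists_zero_of_norm_sub_lt`; `g` is a polynomial) yields a zero of `g` in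
the open disc, whose imaginary part exceeds `Im ζ - ρ > 1/2 > 0`.

References: Conway, *Functions of one complex variable I*, VII.2.5 (Rouché via maximum modulus); Kowalski–
Nikeghbali 2010 [KowalskiNikeghbali2010] (mod-Poisson limits with limiting function `1/Γ`, the source of the
model row).  No number theory is used.
-/

noncomputable section

namespace Summit.Parity.GeneralizedHardyLittlewood.Cruxes.AbsoluteUpgrade.DipMarginRateExchange

open scoped BigOperators
open Summit.Parity.GeneralizedHardyLittlewood.Cruxes.ModelHyperbolicity.WindowChainTransport

/-- **`stub_pencilDiscOfChain`** (registered stub of the line `dip-margin-rate-exchange`): the chain zero of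
the model pencil (`PencilChainZero`) and the mod-Gamma disc asymptotics of the Buchstab–Dickman row
(`ModGammaDisc`) give `MarginPoly` — the tilted row polynomial has a non-real zero — by the maximum-modulus
form of Rouché's theorem on the clearance disc. -/
theorem stub_pencilDiscOfChain : PencilChainZero → ModGammaDisc → MarginPoly := by
  intro hPC hMG m
  obtain ⟨CK', u₁, hMG'⟩ := hMG (m + 2)
  obtain ⟨C, hC, Λ₀, hΛ₀, hPC'⟩ := hPC m (Nat.cast_nonneg m)
  -- normalised constants
  obtain ⟨CK, hCKdef⟩ : ∃ CK : ℝ, CK = max CK' 1 := ⟨_, rfl⟩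
  obtain ⟨Ĉ, hĈdef⟩ : ∃ Ĉ : ℝ, Ĉ = max C 1 := ⟨_, rfl⟩
  have hCK1 : 1 ≤ CK := hCKdef ▸ le_max_right _ _
  have hCK' : CK' ≤ CK := hCKdef ▸ le_max_left _ _
  have hĈ1 : 1 ≤ Ĉ := hĈdef ▸ le_max_right _ _
  have hCĈ : C ≤ Ĉ := hĈdef ▸ le_max_left _ _
  have hĈ0 : 0 < Ĉ := by linarith
  obtain ⟨hB1, hB2, hB3, hB4, hB5⟩ := pencilDisc_consts hĈ1 hCK1 m
  obtain ⟨B, hBdef⟩ :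
      ∃ B : ℝ, B = 256 * Ĉ ^ 3 * CK * 9 ^ (m + 1) * ((m : ℝ) + 3) ^ (m + 3) := ⟨_, rfl⟩
  rw [← hBdef] at hB1 hB2 hB3 hB4 hB5
  refine ⟨max u₁ (max (⌈Real.exp (Λ₀ + 1)⌉₊ + 1) (max 64 (max (m + 3) ⌈B⌉₊))),
    ?_⟩
  intro u hu θ hθlo hθhi b _ hb
  -- unpacking `u ≥ u₀`
  have hu₁ : u₁ ≤ u := le_of_max_le_left hu
  have huΛ : ⌈Real.exp (Λ₀ + 1)⌉₊ + 1 ≤ u := le_of_max_le_left (le_of_max_le_right hu)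
  have hu64 : 64 ≤ u := le_of_max_le_left (le_of_max_le_right (le_of_max_le_right hu))
  have hum3 : m + 3 ≤ u :=
    le_of_max_le_left (le_of_max_le_right (le_of_max_le_right (le_of_max_le_right hu)))
  have huB : B ≤ u := Nat.ceil_le.1
    (le_of_max_le_right (le_of_max_le_right (le_of_max_le_right (le_of_max_le_right hu))))
  have hu2 : 2 ≤ u := le_trans (by norm_num) hu64
  have hu1 : 1 ≤ u := le_trans (by norm_num) hu64
  -- the rate `Λ = log (u - 1) - γ`
  obtain ⟨Λ, hΛdef⟩ :
      ∃ Λ : ℝ, Λ = Real.log ((u : ℝ) - 1) - Real.eulerMascheroniConstant := ⟨_, rfl⟩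
  obtain ⟨hΛ2, hlog2Λ, hlogΛ, -⟩ := pencilDisc_Lambda_facts u hu64
  rw [← hΛdef] at hΛ2 hlog2Λ hlogΛ
  have hΛ0 : 0 < Λ := by linarith
  have hΛρ : Λ * (1 / (4 * Λ)) = 1 / 4 := by field_simp
  have hlogu1 : Real.log ((u : ℝ) - 1) = Λ + Real.eulerMascheroniConstant := by rw [hΛdef]; ring
  have hΛ₀Λ : Λ₀ ≤ Λ := by
    have h1 : Real.exp (Λ₀ + 1) + 1 ≤ u := by
      have : ((⌈Real.exp (Λ₀ + 1)⌉₊ + 1 : ℕ) : ℝ) ≤ u := by exact_mod_cast huΛ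
      push_cast at this
      linarith [Nat.le_ceil (Real.exp (Λ₀ + 1))]
    have h2 : Λ₀ + 1 ≤ Real.log ((u : ℝ) - 1) := by
      rw [← Real.log_exp (Λ₀ + 1)]
      exact Real.log_le_log (Real.exp_pos _) (by linarith)
    have hγ1 : Real.eulerMascheroniConstant < 2 / 3 := Real.eulerMascheroniConstant_lt_two_thirds
    linarith
  -- the tilt size `|θ| = |τ|`, `τ = -θ`, and `x = log|τ|/(2Λ)`
  have ht0 : 0 < |θ| := lt_of_lt_of_le (by positivity) hθlo
  have hτne : (-θ) ≠ 0 := neg_ne_zero.2 (abs_pos.1 ht0)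
  have hx_lo : -(m : ℝ) ≤ Real.log |θ| / (2 * Λ) := by
    rw [le_div_iff₀ (by positivity)]
    have h1 : Real.log (((u : ℝ) ^ m)⁻¹) ≤ Real.log |θ| :=
      Real.log_le_log (by positivity) hθlo
    rw [Real.log_inv, Real.log_pow] at h1
    have h2 : (m : ℝ) * Real.log u ≤ m * (2 * Λ) :=
      mul_le_mul_of_nonneg_left hlog2Λ (Nat.cast_nonneg m)
    linarith
  have hx_hi : Real.log |θ| / (2 * Λ) ≤ Real.log 2 / (2 * Λ) :=
    div_le_div_of_nonneg_right (Real.log_le_log ht0 hθhi) (by positivity)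
  -- the chain zero
  obtain ⟨ζ, him_lo, him_hi, hre, hchain, hclear, hGam⟩ :=
    hPC' Λ hΛ₀Λ (-θ) hτne (by rw [abs_neg]; exact hθhi) (by rw [abs_neg]; exact hx_lo)
  rw [abs_neg] at hre
  have hρ0 : 0 < 1 / (4 * Λ) := by positivity
  obtain ⟨hGm_lo0, hGm_hi0, hGp_lo0, hGp_hi0⟩ :=
    hGam ζ (by rw [sub_self, norm_zero]; exact hρ0.le)
  obtain ⟨hE2, -⟩ :=
    pencilDisc_chain_size Λ (-θ) C ζ hC hchain hGm_lo0 hGm_hi0 hGp_lo0 hGp_hi0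
  rw [abs_neg] at hE2
  have hC2 : C ^ 2 ≤ Ĉ ^ 2 := pow_le_pow_left₀ hC.le hCĈ 2
  have hE2' : Real.exp (2 * Λ * ζ.re) ≤ Ĉ ^ 2 * |θ| :=
    hE2.trans (mul_le_mul_of_nonneg_right hC2 (abs_nonneg _))
  have hEle : Real.exp (Λ * ζ.re) ≤ 2 * Ĉ := by
    have h1 : Real.exp (Λ * ζ.re) ^ 2 ≤ (2 * Ĉ) ^ 2 := by
      calc Real.exp (Λ * ζ.re) ^ 2 = Real.exp (2 * Λ * ζ.re) := by
            rw [sq, ← Real.exp_add]; ring_nf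
        _ ≤ Ĉ ^ 2 * |θ| := hE2'
        _ ≤ Ĉ ^ 2 * 2 := by gcongr
        _ ≤ (2 * Ĉ) ^ 2 := by nlinarith
    exact (pow_le_pow_iff_left₀ (Real.exp_pos _).le (by positivity) two_ne_zero).1 h1
  have hE0 : 0 < Real.exp (Λ * ζ.re) := Real.exp_pos _
  -- the Rouché margin
  obtain ⟨δ, hδ⟩ : ∃ δ : ℝ, δ = |θ| / (8 * Ĉ * Real.exp (Λ * ζ.re)) := ⟨_, rfl⟩
  have hδ0 : 0 < δ := by rw [hδ]; positivity
  -- the model pencil (product form) and the row polynomial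
  set f : ℂ → ℂ := fun z => Complex.exp (-((Λ : ℂ) * z)) *
      (Complex.exp (2 * (Λ : ℂ) * z) * Complex.Gamma (1 - z) -
          ((-θ : ℝ) : ℂ) * Complex.Gamma (1 + z)) /
        (Complex.Gamma (1 + z) * Complex.Gamma (1 - z)) with hfdef
  set g : ℂ → ℂ := fun z => ∑ j ∈ Finset.range u, (b j : ℂ) * z ^ j with hgdef
  have hf0 : f ζ = 0 := by
    simp only [hfdef]
    rw [hchain, sub_self, mul_zero, zero_div]
  have hg : DiffContOnCl ℂ g (Metric.ball ζ (1 / (4 * Λ))) := by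
    apply Differentiable.diffContOnCl
    simp only [hgdef]
    fun_prop
  -- lower bound on the circle
  have hsphere : ∀ z ∈ Metric.sphere ζ (1 / (4 * Λ)), δ ≤ ‖f z‖ := by
    intro z hz
    rw [Metric.mem_sphere, dist_eq_norm] at hz
    obtain ⟨hGm_lo, hGm_hi, hGp_lo, -⟩ := hGam z hz.le
    have hCi : 0 < C⁻¹ := inv_pos.2 hC
    have hlow := pencilDisc_sphere_lower Λ (-θ) C z hC (hCi.trans_le hGp_lo) hGm_hi
      (hCi.trans_le hGm_lo) (hclear z hz)
    rw [abs_neg] at hlow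
    have hzre : Λ * z.re ≤ Λ * ζ.re + 1 / 4 := by
      have h1 : |(z - ζ).re| ≤ 1 / (4 * Λ) := (Complex.abs_re_le_norm _).trans hz.le
      rw [Complex.sub_re, abs_le] at h1
      have h2 := mul_le_mul_of_nonneg_left h1.2 hΛ0.le
      rw [mul_sub, hΛρ] at h2
      linarith
    have hexp : (Real.exp (Λ * ζ.re))⁻¹ * (3 / 4) ≤ Real.exp (-(Λ * z.re)) := by
      calc (Real.exp (Λ * ζ.re))⁻¹ * (3 / 4)
          ≤ (Real.exp (Λ * ζ.re))⁻¹ * Real.exp (-(1 / 4)) := by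
            gcongr; linarith [Real.add_one_le_exp (-(1 / 4 : ℝ))]
        _ = Real.exp (-(Λ * ζ.re) + -(1 / 4)) := by rw [Real.exp_add, Real.exp_neg, Real.exp_neg]
        _ ≤ Real.exp (-(Λ * z.re)) := Real.exp_le_exp.2 (by linarith)
    simp only [hfdef]
    refine le_trans ?_ hlow
    calc δ = |θ| / (8 * Ĉ * Real.exp (Λ * ζ.re)) := hδ
      _ ≤ |θ| / (5 * C) * ((Real.exp (Λ * ζ.re))⁻¹ * (3 / 4)) := by
          rw [show |θ| / (5 * C) * ((Real.exp (Λ * ζ.re))⁻¹ * (3 / 4)) =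
              3 * |θ| / (20 * C * Real.exp (Λ * ζ.re)) by field_simp; ring]
          rw [div_le_div_iff₀ (by positivity) (by positivity)]
          calc |θ| * (20 * C * Real.exp (Λ * ζ.re))
              = 20 * C * (|θ| * Real.exp (Λ * ζ.re)) := by ring
            _ ≤ 20 * Ĉ * (|θ| * Real.exp (Λ * ζ.re)) := by gcongr
            _ ≤ 24 * Ĉ * (|θ| * Real.exp (Λ * ζ.re)) := by gcongr; norm_num
            _ = 3 * |θ| * (8 * Ĉ * Real.exp (Λ * ζ.re)) := by ring
      _ ≤ |θ| / (5 * C) * Real.exp (-(Λ * z.re)) := by gcongr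
  -- closeness on the closed disc
  have hclose : ∀ z ∈ Metric.closedBall ζ (1 / (4 * Λ)), ‖g z - f z‖ < δ / 2 := by
    intro z hz
    rw [Metric.mem_closedBall, dist_eq_norm] at hz
    obtain ⟨g1, g2, g3, g4, g5, g6, g7, -⟩ :=
      pencilDisc_disc_geometry hΛ2 hx_lo hx_hi hre him_lo him_hi hz
    obtain ⟨hGm_lo, -, hGp_lo, -⟩ := hGam z hz
    have hCi : 0 < C⁻¹ := inv_pos.2 hC
    have hGp : Complex.Gamma (1 + z) ≠ 0 := norm_pos_iff.1 (hCi.trans_le hGp_lo)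
    have hGm : Complex.Gamma (1 - z) ≠ 0 := norm_pos_iff.1 (hCi.trans_le hGm_lo)
    -- the pencil in additive form
    have hfz : f z = Complex.exp ((Λ : ℂ) * z) / Complex.Gamma (1 + z) -
        ((-θ : ℝ) : ℂ) * (Complex.exp (-((Λ : ℂ) * z)) / Complex.Gamma (1 - z)) := by
      simp only [hfdef]
      exact pencilDisc_pencil_eq Λ (-θ) z hGp hGm
    -- the model terms (`ModGammaDisc` at `z` and at `-z`)
    have hzK : ‖z‖ ≤ ((m + 2 : ℕ) : ℝ) + 1 := by push_cast; linarith
    have hmodel : ∀ w : ℂ,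
        Complex.exp (-(Real.eulerMascheroniConstant : ℂ) * w) * (((u : ℂ) - 1) ^ w) =
          Complex.exp ((Λ : ℂ) * w) := by
      intro w; rw [pencilDisc_model_eq u hu2 w, hΛdef]
    have hM1 : ‖(∑ j ∈ Finset.range u, (cellDensity j u : ℂ) * z ^ j) -
        Complex.exp ((Λ : ℂ) * z) / Complex.Gamma (1 + z)‖ ≤
          CK / u * Real.exp (z.re * (Λ + Real.eulerMascheroniConstant)) := by
      have h := hMG' u hu₁ z hzK
      rw [hmodel z, pencilDisc_norm_cpow u hu2, hlogu1] at h
      refine h.trans ?_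
      gcongr
    have hM2 : ‖(∑ j ∈ Finset.range u, (cellDensity j u : ℂ) * (-z) ^ j) -
        Complex.exp (-((Λ : ℂ) * z)) / Complex.Gamma (1 - z)‖ ≤
          CK / u * Real.exp (-z.re * (Λ + Real.eulerMascheroniConstant)) := by
      have h := hMG' u hu₁ (-z) (by rwa [norm_neg])
      rw [hmodel (-z), pencilDisc_norm_cpow u hu2, hlogu1, Complex.neg_re, mul_neg,
        show (1 : ℂ) + -z = 1 - z by ring] at h
      refine h.trans ?_
      gcongr
    -- the three estimates
    have hT1 : ‖(∑ j ∈ Finset.range u, (cellDensity j u : ℂ) * z ^ j) -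
        Complex.exp ((Λ : ℂ) * z) / Complex.Gamma (1 + z)‖ ≤ δ / 8 := by
      refine hM1.trans ?_
      have := pencilDisc_term1 hĈ1 hCK1 ht0 hΛ2 g1 g3 hE2' (hB1.trans huB)
      refine this.trans (le_of_eq ?_)
      rw [hδ]; ring
    have hT2 : ‖((-θ : ℝ) : ℂ) *
        ((∑ j ∈ Finset.range u, (cellDensity j u : ℂ) * (-z) ^ j) -
          Complex.exp (-((Λ : ℂ) * z)) / Complex.Gamma (1 - z))‖ ≤ δ / 8 := by
      rw [norm_mul, Complex.norm_real, Real.norm_eq_abs, abs_neg]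
      refine (mul_le_mul_of_nonneg_left hM2 (abs_nonneg θ)).trans ?_
      have := pencilDisc_term2 hĈ1 hCK1 ht0 hΛ2 g2 g4 (hB2.trans huB)
      refine this.trans (le_of_eq ?_)
      rw [hδ]; ring
    have hT3 : ‖g z -
        ∑ j ∈ Finset.range u, (((1 + θ * (-1) ^ j) * cellDensity j u : ℝ) : ℂ) * z ^ j‖ ≤
          δ / 16 + δ / 16 := by
      simp only [hgdef]
      refine (pencilDisc_coeff_bound u m hu1 θ b hb z g6).trans (add_le_add ?_ ?_)
      · have := pencilDisc_term3a hĈ1 hθlo hΛ2 g2 g4 g3 hlogΛ hEle (hB3.trans huB)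
          (hB4.trans huB)
        refine this.trans (le_of_eq ?_)
        rw [hδ]; ring
      · have hm0 : (0 : ℝ) ≤ m := Nat.cast_nonneg m
        have hgeom := pencilDisc_geom_le u (R := |z.re| + 2) (a := (m : ℝ) + 3) (by positivity)
          (by linarith) (by linarith)
        calc ((u : ℝ) ^ u)⁻¹ * ∑ j ∈ Finset.range u, (|z.re| + 2) ^ j
            ≤ ((u : ℝ) ^ u)⁻¹ * ((u : ℝ) * ((m : ℝ) + 3) ^ u) := by gcongr
          _ ≤ δ / 16 := by
              have := pencilDisc_term3b hĈ1 hθlo hEle hum3 (hB5.trans huB)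
              refine this.trans (le_of_eq ?_)
              rw [hδ]; ring
    -- assembling
    have htilt := pencilDisc_tilt_sum u θ z
    have hdecomp : g z - f z =
        (g z -
          ∑ j ∈ Finset.range u, (((1 + θ * (-1) ^ j) * cellDensity j u : ℝ) : ℂ) * z ^ j) +
        (((∑ j ∈ Finset.range u, (cellDensity j u : ℂ) * z ^ j) -
            Complex.exp ((Λ : ℂ) * z) / Complex.Gamma (1 + z)) -
          ((-θ : ℝ) : ℂ) * ((∑ j ∈ Finset.range u, (cellDensity j u : ℂ) * (-z) ^ j) -
            Complex.exp (-((Λ : ℂ) * z)) / Complex.Gamma (1 - z))) := by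
      rw [hfz, ← htilt]; push_cast; ring
    rw [hdecomp]
    refine lt_of_le_of_lt ((norm_add_le _ _).trans
      (add_le_add hT3 ((norm_sub_le _ _).trans (add_le_add hT1 hT2)))) ?_
    linarith
  -- Rouché
  obtain ⟨z, hz, hgz⟩ :=
    Literature.NumberTheory.LFunctions.exists_zero_of_norm_sub_lt hρ0 hg hf0 hsphere hclose
  refine ⟨z, by simpa only [hgdef] using hgz, ?_⟩
  rw [Metric.mem_ball, dist_eq_norm] at hz
  obtain ⟨-, -, -, -, -, -, -, him⟩ :=
    pencilDisc_disc_geometry hΛ2 hx_lo hx_hi hre him_lo him_hi hz.le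
  exact ne_of_gt (by linarith)

end Summit.Parity.GeneralizedHardyLittlewood.Cruxes.AbsoluteUpgrade.DipMarginRateExchange

end
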